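import Literature.MathematicalPhysics.QuantumFieldTheory.Balaban1983to89.Beta.RemainderDecay190SectGBlocks
import Summits.QuantumFields.BalabanUV.Gaps.D4WalkBlock

/-!
# RemainderDecay190BlockNorm — the gaps cell's cube-to-cube `blockNorm` letters (`Gaps.D4WalkBlock`) ARE NODE D's
# `HasMaj.ofBlocks` letters of the (D4) socket's (190)-field: the read-off between the two currencies

Cell `pub-balaban`, β-function sub-cell, BINDER row D4 «RemainderConst leaves for Bałaban's split» (`HOME/BINDER-OWNERS.md`;
owner lineage `b2b-balaban-beta-an4`, generation 92), β-FLOW TEAM duty (1), FREEZE (0) honoured (def-free; no leaf, no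
hypothesis shape; imports ONE Literature module of the lineage and ONE `Gaps` module of the cell `pub-balaban-gaps`).

HONEST FRAMING (page 1, verbatim and binding).  *"Discharging BetaPertH makes Bałaban's UV stability UNCONDITIONAL — a real
constructive-QFT result; it is NOT the continuum limit and NOT the Clay problem."*  THIS FILE DISCHARGES NOTHING OF THE KIND.  A
[folklore] dictionary between two typed currencies for the SAME printed shape — [B9] (3.108) p. 416 ∕ [15] (190) p. 308: bounds of
operators BLOCK TO BLOCK («x ∈ Δ(y), supp ⊂ Δ(y′)»).  Nothing of Bałaban's is constructed or asserted; the matrices and block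
(cube) maps are parameters (NODE O).  Row D4 class UNCHANGED (critical-path width 0; instance 0∕1; D4 DISCHARGE NO DATE).
HONEST DEPENDENCY: continuum YM on T⁴ ⇐ BetaPertH ∧ nine spine estimates (0/9 proved); BetaPertH ⇐ (D1) ∧ (D4) ∧ CAP+tail;
G-an2-4 gates asym, D1 and NE2/3/4.

THE TWO CURRENCIES.  (i) The gaps cell's NODE-O walk calculus in its block form (`Gaps.D4WalkBlock`, seat g1-p2; design note
`BLOCKNORM-ADAPTER.md`): for a COMPLEX matrix `T : Matrix p n ℂ` with cube maps `cub : p → UT K`, `cubn : n → UT K`,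
`rowMass cubn T i y′ = Σ_{j ∈ cubn⁻¹ y′} ‖T i j‖` and `blockNorm cub cubn T y y′` = the sup of the row masses over the rows in
cube `y` — the ℓ^∞ → ℓ^∞ norm of the `(y, y′)` block; a `BlockWalkExpansion` delivers `blockNorm … ≤ A·e^{−ρD}`.  (ii) NODE D
of the (D4) socket (`Beta.RemainderDecay190SectG*`, this lineage): `B11SectG.HasMaj (ofBlocks 𝔅 blk₁) (ofBlocks 𝔅 blk₂) T K` for a
REAL linear map between function lattices, which by generation 92's `RemainderDecay190SectGBlocks.hasMaj_ofBlocks_iff_blockRowSum_le`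
IS the block row-mass bound `Σ_{x₁ ∈ blk₁⁻¹ y′} |T(δ_{x₁})(x)| ≤ K(blk₂ x, y′)`.

WHAT IS PROVED ([folklore]; 0 `def`, 0 sorry).  §1 `rowSum_abs_re_le_rowMass` (the row mass of the REAL PART is below the row
mass), `rowMass_map_ofReal` (for a real matrix embedded in ℂ the row mass IS `Σ |A i j|`), `kernel_nonneg_of_blockNorm_le`.
§2 **`blockRowSum_re_le_of_blockNorm_le`** (`blockNorm cub cubn T ≤ K` ⟹ the real part `T.map re` has block row masses ≤ K),
**`hasMaj_ofBlocks_re_of_blockNorm_le`** (⟹ `HasMaj (ofBlocks 𝔅 cubn) (ofBlocks 𝔅 cub) (toLin' (T.map re)) K` on every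
`toB6 (torusGeom K η L M) R H` carrier of the torus of cubes — the letter shape of `RemainderDecay190SectG.h190_of_sectG` ∕
`…SectGTorus.h190_of_sectG_torusGeom`), `hasMajorantHom_re_of_blockNorm_le` (pv08's two-lattice majorant).  §3 for REAL matrices
embedded in ℂ: `blockNorm_ofReal_le_of_blockRowSum_le` ∕ `blockRowSum_le_of_blockNorm_ofReal_le` ∕ **`blockNorm_ofReal_le_iff`**
(`K ≥ 0`: `blockNorm cub cubn (A.map ofReal) ≤ K` ⟺ `Σ_{j ∈ cubn⁻¹ y′} |A i j| ≤ K(cub i, y′)`), hence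
**`hasMaj_ofBlocks_iff_blockNorm_ofReal_le`**.  §4 the junction **`block190_re_of_blockNorm_le`**: (190) for the REAL PART of δ𝓗 in
block form, `Σ_{x′ ∈ blkB⁻¹ y′} |Re δ𝓗_n x x′| ≤ Cst·e^{−⅛δ15·d₁(blkA x, y′)}`, from `blockNorm` letters of the seven operators as
complex matrices + the carriers (184)∕(182) of their real parts — a block-walk-expanded family evaluated at its physical parameters
feeds NODE D with no conversion to entries and no fibre factor; **`blockNorm190_of_blockNorm_le`**: the same with the
COMPLEX carriers (184)∕(182) and the reality letters `im = 0` of the seven operators at the evaluation point (NODE O's letter; δ𝓗's follows by (182)), the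
real-part carriers derived inside, conclusion in the cell's own currency `blockNorm (blkA n) (blkB n) (δ𝓗_n) y y′ ≤
Cst·e^{−⅛δ15·d₁(y,y′)}` (g1-plan-1 GEN 14's located point W-1 (a)).
-/

namespace Summit.QuantumFields.BalabanUV.Beta.RemainderDecay190BlockNorm

open Literature.MathematicalPhysics.QuantumFieldTheory.Balaban1983to89 B11SectG
open Literature.MathematicalPhysics.QuantumFieldTheory.Balaban1983to89.B6RandomWalkHom (HasMajorantHom)
open Literature.MathematicalPhysics.QuantumFieldTheory.Balaban1983to89.B9Thm34Ext (toB6)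
open Literature.MathematicalPhysics.QuantumFieldTheory.Balaban1983to89.B9Thm37GlueTorus (torusGeom tdist1)
open Literature.MathematicalPhysics.QuantumFieldTheory.Balaban1983to89.B5TorusCover (UT)
open Literature.MathematicalPhysics.QuantumFieldTheory.Balaban1983to89.Beta.RemainderDecay190SectGBlocks
open Summit.QuantumFields.BalabanUV.Gaps.D4WalkBlock
  (rowMass blockNorm rowMass_le_blockNorm blockNorm_le_of_rowMass_le blockNorm_nonneg)

variable {ν : ℕ} {K : Fin ν → ℕ} {p n : Type} [Fintype p] [Fintype n]

/-! ## §1 Row masses of real parts and of embedded real matrices -/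

omit [Fintype p] in
/-- The block row mass of the REAL PART of a complex matrix is below its block row mass (`|re z| ≤ ‖z‖`). [folklore] -/
theorem rowSum_abs_re_le_rowMass (cubn : n → UT K) (T : Matrix p n ℂ) (i : p) (y' : UT K) :
    ∑ j ∈ Finset.univ.filter (fun j => cubn j = y'), |(T.map Complex.re) i j| ≤ rowMass cubn T i y' :=
  Finset.sum_le_sum fun j _ => by
    rw [Matrix.map_apply]
    exact Complex.abs_re_le_norm (T i j)

omit [Fintype p] in
/-- For a real matrix embedded in ℂ the block row mass IS `Σ_{j ∈ cubn⁻¹ y′} |A i j|`. [folklore] -/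
theorem rowMass_map_ofReal (cubn : n → UT K) (A : Matrix p n ℝ) (i : p) (y' : UT K) :
    rowMass cubn (A.map ((↑) : ℝ → ℂ)) i y' = ∑ j ∈ Finset.univ.filter (fun j => cubn j = y'), |A i j| := by
  refine Finset.sum_congr rfl fun j _ => ?_
  rw [Matrix.map_apply, Complex.norm_real, Real.norm_eq_abs]

/-- A kernel dominating block norms is non-negative. [folklore] -/
theorem kernel_nonneg_of_blockNorm_le (cub : p → UT K) (cubn : n → UT K) (T : Matrix p n ℂ)
    {Kf : UT K → UT K → ℝ} (h : ∀ y y', blockNorm cub cubn T y y' ≤ Kf y y') : ∀ y y', 0 ≤ Kf y y' :=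
  fun y y' => (blockNorm_nonneg cub cubn T y y').trans (h y y')

/-! ## §2 `blockNorm` letters ⟹ NODE D letters for the real part -/

/-- **`blockNorm ≤ K` ⟹ the real part has block row masses ≤ K** (row `i`, column cube `y′`, kernel read at `(cub i, y′)`).
[folklore] -/
theorem blockRowSum_re_le_of_blockNorm_le (cub : p → UT K) (cubn : n → UT K) (T : Matrix p n ℂ)
    {Kf : UT K → UT K → ℝ} (h : ∀ y y', blockNorm cub cubn T y y' ≤ Kf y y') :
    ∀ (i : p) (y' : UT K),
      ∑ j ∈ Finset.univ.filter (fun j => cubn j = y'), |(T.map Complex.re) i j| ≤ Kf (cub i) y' :=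
  fun i y' => (rowSum_abs_re_le_rowMass cubn T i y').trans ((rowMass_le_blockNorm cub cubn T i y').trans (h _ _))

variable [DecidableEq n]

/-- **THE READ-OFF**: `blockNorm cub cubn T ≤ K` for a complex matrix `T` (rows `p` in cubes by `cub`, columns `n` in cubes by
`cubn`) ⟹ the real linear map of its REAL PART, `toLin' (T.map re) : (n → ℝ) →ₗ[ℝ] (p → ℝ)`, has the block majorant `K`
between the sharp block sup-sizes `ofBlocks 𝔅 cubn` → `ofBlocks 𝔅 cub` on any `toB6 (torusGeom K η L M) R H` carrier of the
torus of cubes (its distance is `tdist1 K` whatever the carried letters) — the letter shape consumed by NODE D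
(`RemainderDecay190SectGTorus.h190_of_sectG_torusGeom`). [folklore] -/
theorem hasMaj_ofBlocks_re_of_blockNorm_le [∀ i, NeZero (K i)] {η L M R : ℝ} {H : Prop} (cub : p → UT K)
    (cubn : n → UT K) (T : Matrix p n ℂ) {Kf : UT K → UT K → ℝ} (h : ∀ y y', blockNorm cub cubn T y y' ≤ Kf y y') :
    HasMaj (BlockNorm.ofBlocks (toB6 (torusGeom K η L M) R H) cubn) (BlockNorm.ofBlocks (toB6 (torusGeom K η L M) R H) cub)
      (Matrix.toLin' (T.map Complex.re)) Kf := by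
  letI : DecidableEq (toB6 (torusGeom K η L M) R H).Site := (inferInstance : DecidableEq (UT K))
  exact hasMaj_ofBlocks_toLin'_of_blockRowSum_le (g := toB6 (torusGeom K η L M) R H) cubn cub (T.map Complex.re)
    (kernel_nonneg_of_blockNorm_le cub cubn T h) (blockRowSum_re_le_of_blockNorm_le cub cubn T h)

/-- The same in pv08's two-lattice vocabulary: `HasMajorantHom cubn cub (toLin' (T.map re)) K` (any `B6.Geometry` whose sites
are the cubes is fine; stated on the `toB6 (torusGeom K η L M) R H` carrier). [folklore] -/
theorem hasMajorantHom_re_of_blockNorm_le [∀ i, NeZero (K i)] {η L M R : ℝ} {H : Prop} (cub : p → UT K)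
    (cubn : n → UT K) (T : Matrix p n ℂ) {Kf : UT K → UT K → ℝ} (h : ∀ y y', blockNorm cub cubn T y y' ≤ Kf y y') :
    HasMajorantHom (g := toB6 (torusGeom K η L M) R H) cubn cub (Matrix.toLin' (T.map Complex.re)) Kf := by
  letI : DecidableEq (toB6 (torusGeom K η L M) R H).Site := (inferInstance : DecidableEq (UT K))
  exact hasMajorantHom_of_hasMaj_ofBlocks (g := toB6 (torusGeom K η L M) R H) cubn cub
    (kernel_nonneg_of_blockNorm_le cub cubn T h) (hasMaj_ofBlocks_re_of_blockNorm_le cub cubn T h)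

/-! ## §3 Real matrices embedded in ℂ: the two currencies coincide -/

omit [DecidableEq n] in
/-- Block row masses ≤ K (`K ≥ 0`) ⟹ `blockNorm (A.map ofReal) ≤ K`. [folklore] -/
theorem blockNorm_ofReal_le_of_blockRowSum_le (cub : p → UT K) (cubn : n → UT K) (A : Matrix p n ℝ)
    {Kf : UT K → UT K → ℝ} (hK : ∀ y y', 0 ≤ Kf y y')
    (h : ∀ (i : p) (y' : UT K), ∑ j ∈ Finset.univ.filter (fun j => cubn j = y'), |A i j| ≤ Kf (cub i) y') :
    ∀ y y', blockNorm cub cubn (A.map ((↑) : ℝ → ℂ)) y y' ≤ Kf y y' :=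
  fun y y' => blockNorm_le_of_rowMass_le cub cubn _ y y' (hK y y') fun i hi => by
    rw [rowMass_map_ofReal, ← hi]; exact h i y'

omit [DecidableEq n] in
/-- `blockNorm (A.map ofReal) ≤ K` ⟹ block row masses ≤ K. [folklore] -/
theorem blockRowSum_le_of_blockNorm_ofReal_le (cub : p → UT K) (cubn : n → UT K) (A : Matrix p n ℝ)
    {Kf : UT K → UT K → ℝ} (h : ∀ y y', blockNorm cub cubn (A.map ((↑) : ℝ → ℂ)) y y' ≤ Kf y y') :
    ∀ (i : p) (y' : UT K), ∑ j ∈ Finset.univ.filter (fun j => cubn j = y'), |A i j| ≤ Kf (cub i) y' :=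
  fun i y' => by
    rw [← rowMass_map_ofReal cubn A i y']
    exact (rowMass_le_blockNorm cub cubn _ i y').trans (h _ _)

omit [DecidableEq n] in
/-- **The two currencies coincide on real matrices** (`K ≥ 0`). [folklore] -/
theorem blockNorm_ofReal_le_iff (cub : p → UT K) (cubn : n → UT K) (A : Matrix p n ℝ) {Kf : UT K → UT K → ℝ}
    (hK : ∀ y y', 0 ≤ Kf y y') :
    (∀ y y', blockNorm cub cubn (A.map ((↑) : ℝ → ℂ)) y y' ≤ Kf y y') ↔
      ∀ (i : p) (y' : UT K), ∑ j ∈ Finset.univ.filter (fun j => cubn j = y'), |A i j| ≤ Kf (cub i) y' :=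
  ⟨blockRowSum_le_of_blockNorm_ofReal_le cub cubn A, blockNorm_ofReal_le_of_blockRowSum_le cub cubn A hK⟩

/-- **NODE D's letter ⟺ the gaps cell's letter** for a real matrix (`K ≥ 0`): `HasMaj (ofBlocks 𝔅 cubn) (ofBlocks 𝔅 cub)
(toLin' A) K` on the torus-of-cubes carrier ⟺ `blockNorm cub cubn (A.map ofReal) ≤ K`. [folklore] -/
theorem hasMaj_ofBlocks_iff_blockNorm_ofReal_le [∀ i, NeZero (K i)] {η L M R : ℝ} {H : Prop} (cub : p → UT K)
    (cubn : n → UT K) (A : Matrix p n ℝ) {Kf : UT K → UT K → ℝ} (hK : ∀ y y', 0 ≤ Kf y y') :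
    HasMaj (BlockNorm.ofBlocks (toB6 (torusGeom K η L M) R H) cubn) (BlockNorm.ofBlocks (toB6 (torusGeom K η L M) R H) cub)
      (Matrix.toLin' A) Kf ↔ ∀ y y', blockNorm cub cubn (A.map ((↑) : ℝ → ℂ)) y y' ≤ Kf y y' := by
  letI : DecidableEq (toB6 (torusGeom K η L M) R H).Site := (inferInstance : DecidableEq (UT K))
  rw [blockNorm_ofReal_le_iff cub cubn A hK]
  exact ⟨blockRowSum_le_of_hasMaj_ofBlocks_toLin' (g := toB6 (torusGeom K η L M) R H) cubn cub A hK,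
    hasMaj_ofBlocks_toLin'_of_blockRowSum_le (g := toB6 (torusGeom K η L M) R H) cubn cub A hK⟩

/-! ## §4 (190) from `blockNorm` letters: the junction theorem -/

section Junction

variable {Nf : ℕ → Fin ν → ℕ} [∀ n i, NeZero (Nf n i)]
variable {XB XA X3 : ℕ → Type} [∀ n, Fintype (XB n)] [∀ n, Fintype (XA n)] [∀ n, Fintype (X3 n)]
  [∀ n, DecidableEq (XB n)] [∀ n, DecidableEq (XA n)] [∀ n, DecidableEq (X3 n)]

/-- **(190) ON THE TORUS OF CUBES FROM `blockNorm` LETTERS.**  Per step n: cube maps `blkB n`, `blkA n`, `blk3 n` of the B-, A- and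
|·|₍₋₃₎-lattices into the torus of cubes `UT (Nf n)`; the seven Sect. G operators as COMPLEX matrices (the values of matrix-valued
NODE-O objects) with the gaps cell's cube-to-cube letters `blockNorm cub cubn T y y′ ≤ a·e^{−r·d₁(y,y′)}` — G̃ (B_G, δ₀), (189) W
(θ_W, ¼δ₀), Δ⁽²⁾H₀ (c_Δ, δ₀), H₀ (A₀, δ₀), H (A_H, ½δ₀), 𝔇 (θ_𝔇, ½δ₀), (188) 𝔄₀ ≤ M₀(n) —, the carriers (184) ∕ (182) as identities
of the REAL PARTS (the physical operators; supplied by the builder), the Neumann ratio `qG 1 1 B_G θ_W c < 1` with `c ≥ c₀(σ∕δ₀)^ν`,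
`0 < σ ≤ ⅛δ₀`, `Cst` above the written-out O(1), `δ15 ≤ δ₀` ⟹ (190) for the real part of δ𝓗 in block form:
`Σ_{x′ ∈ blkB⁻¹ y′} |Re δ𝓗_n x x′| ≤ Cst·e^{−⅛δ15·d₁(blkA x, y′)}` — `RemainderDecay190SectGBlocks.block190_of_sectG_torusGeom_toLin'`
with every letter read in by `blockRowSum_re_le_of_blockNorm_le`.  Nothing of Bałaban's is constructed; matrices and cube maps are
parameters (NODE O). [folklore] -/
theorem block190_re_of_blockNorm_le
    (blkB : (n : ℕ) → XB n → UT (Nf n)) (blkA : (n : ℕ) → XA n → UT (Nf n)) (blk3 : (n : ℕ) → X3 n → UT (Nf n))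
    (Gt : (n : ℕ) → Matrix (XA n) (X3 n) ℂ) (W : (n : ℕ) → Matrix (X3 n) (XA n) ℂ)
    (D2H0 : (n : ℕ) → Matrix (X3 n) (XB n) ℂ)
    (H0 Hk A0 dH : (n : ℕ) → Matrix (XA n) (XB n) ℂ) (Dfr : (n : ℕ) → Matrix (XB n) (XA n) ℂ)
    (M₀ : ℕ → ℝ) {δ₀ σ c BG θW cΔ A₀ AH₂ θD Cst δ15 : ℝ}
    (hδ₀ : 0 < δ₀) (hσ₀ : 0 < σ) (hσ : σ ≤ δ₀ / 8) (hc : B6.c0 δ₀ (σ / δ₀) ^ ν ≤ c)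
    (hBG : 0 ≤ BG) (hθW : 0 ≤ θW) (hcΔ : 0 ≤ cΔ) (hA₀ : 0 ≤ A₀) (hAH₂ : 0 ≤ AH₂) (hθD : 0 ≤ θD) (hM₀ : ∀ n, 0 ≤ M₀ n)
    (hG : ∀ n y y', blockNorm (blkA n) (blk3 n) (Gt n) y y' ≤ BG * Real.exp (-(δ₀ * tdist1 (Nf n) y y')))
    (h189 : ∀ n y y', blockNorm (blk3 n) (blkA n) (W n) y y' ≤ θW * Real.exp (-(δ₀ / 4 * tdist1 (Nf n) y y')))
    (hD2H0 : ∀ n y y', blockNorm (blk3 n) (blkB n) (D2H0 n) y y' ≤ cΔ * Real.exp (-(δ₀ * tdist1 (Nf n) y y')))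
    (hH0 : ∀ n y y', blockNorm (blkA n) (blkB n) (H0 n) y y' ≤ A₀ * Real.exp (-(δ₀ * tdist1 (Nf n) y y')))
    (hH : ∀ n y y', blockNorm (blkA n) (blkB n) (Hk n) y y' ≤ AH₂ * Real.exp (-(δ₀ / 2 * tdist1 (Nf n) y y')))
    (hDfr : ∀ n y y', blockNorm (blkB n) (blkA n) (Dfr n) y y' ≤ θD * Real.exp (-(δ₀ / 2 * tdist1 (Nf n) y y')))
    (h188 : ∀ n y y', blockNorm (blkA n) (blkB n) (A0 n) y y' ≤ M₀ n)
    (h184 : ∀ n, (A0 n).map Complex.re + ((Gt n).map Complex.re * (W n).map Complex.re) * (A0 n).map Complex.re =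
      (Gt n).map Complex.re * (D2H0 n).map Complex.re - ((Gt n).map Complex.re * (W n).map Complex.re) * (H0 n).map Complex.re)
    (h182 : ∀ n, (dH n).map Complex.re = ((A0 n).map Complex.re + (H0 n).map Complex.re) -
      (Hk n).map Complex.re * ((Dfr n).map Complex.re * ((A0 n).map Complex.re + (H0 n).map Complex.re)))
    (hq : qG 1 1 BG θW c < 1)
    (hCst : (1 * BG * (cΔ + 1 * θW * (A₀ + constA0 1 1 BG θW cΔ A₀ c) * c) * c + A₀) +
        1 * AH₂ * (1 * θD * (constA0 1 1 BG θW cΔ A₀ c + A₀) * c) * c ≤ Cst)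
    (hδ15 : δ15 ≤ δ₀) :
    ∀ n (x : XA n) (y' : UT (Nf n)),
      ∑ x' ∈ Finset.univ.filter (fun x' => blkB n x' = y'), |(dH n x x').re| ≤
        Cst * Real.exp (-(δ15 / 8 * tdist1 (Nf n) (blkA n x) y')) := by
  have h := block190_of_sectG_torusGeom_toLin' blkB blkA blk3 (fun n => (Gt n).map Complex.re)
    (fun n => (W n).map Complex.re) (fun n => (D2H0 n).map Complex.re) (fun n => (H0 n).map Complex.re)
    (fun n => (Hk n).map Complex.re) (fun n => (A0 n).map Complex.re) (fun n => (dH n).map Complex.re)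
    (fun n => (Dfr n).map Complex.re) M₀ hδ₀ hσ₀ hσ hc hBG hθW hcΔ hA₀ hAH₂ hθD hM₀
    (fun n => blockRowSum_re_le_of_blockNorm_le (blkA n) (blk3 n) (Gt n) (hG n))
    (fun n => blockRowSum_re_le_of_blockNorm_le (blk3 n) (blkA n) (W n) (h189 n))
    (fun n => blockRowSum_re_le_of_blockNorm_le (blk3 n) (blkB n) (D2H0 n) (hD2H0 n))
    (fun n => blockRowSum_re_le_of_blockNorm_le (blkA n) (blkB n) (H0 n) (hH0 n))
    (fun n => blockRowSum_re_le_of_blockNorm_le (blkA n) (blkB n) (Hk n) (hH n))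
    (fun n => blockRowSum_re_le_of_blockNorm_le (blkB n) (blkA n) (Dfr n) (hDfr n))
    (fun n => blockRowSum_re_le_of_blockNorm_le (blkA n) (blkB n) (A0 n) (h188 n)) h184 h182 hq hCst hδ15
  intro n x y'
  simpa only [Matrix.map_apply] using h n x y'

/-! ### Real-valued complex matrices: complex carriers in, `blockNorm` bound out (g1-plan-1 GEN 14's located point W-1 (a)) -/

/-- For entrywise-real complex matrices, `map re` is multiplicative. [folklore] -/
theorem map_re_mul_of_im_eq_zero {l m k : Type} [Fintype m] (A : Matrix l m ℂ) (B : Matrix m k ℂ)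
    (hA : ∀ i j, (A i j).im = 0) (hB : ∀ i j, (B i j).im = 0) :
    (A * B).map Complex.re = A.map Complex.re * B.map Complex.re := by
  ext i j
  simp only [Matrix.map_apply, Matrix.mul_apply, Complex.re_sum, Complex.mul_re, hA, hB, mul_zero, sub_zero]

/-- Products of entrywise-real complex matrices are entrywise real. [folklore] -/
theorem mul_im_eq_zero {l m k : Type} [Fintype m] (A : Matrix l m ℂ) (B : Matrix m k ℂ)
    (hA : ∀ i j, (A i j).im = 0) (hB : ∀ i j, (B i j).im = 0) : ∀ i j, ((A * B) i j).im = 0 := by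
  intro i j
  simp only [Matrix.mul_apply, Complex.im_sum, Complex.mul_im, hA, hB, mul_zero, zero_mul, add_zero,
    Finset.sum_const_zero]

/-- `map re` is additive and subtractive on complex matrices. [folklore] -/
theorem map_re_add {l m : Type} (A B : Matrix l m ℂ) :
    (A + B).map Complex.re = A.map Complex.re + B.map Complex.re :=
  Matrix.map_add Complex.re (fun a b => Complex.add_re a b) A B

/-- `map re` is subtractive on complex matrices. [folklore] -/
theorem map_re_sub {l m : Type} (A B : Matrix l m ℂ) :
    (A - B).map Complex.re = A.map Complex.re - B.map Complex.re :=
  Matrix.map_sub Complex.re (fun a b => Complex.sub_re a b) A B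

/-- **(190) IN THE GAPS CELL'S OWN CURRENCY — `blockNorm` letters in, COMPLEX carriers in, `blockNorm` bound out — for
ENTRYWISE-REAL matrices.**  As `block190_re_of_blockNorm_le`, but the carriers (184) ∕ (182) are the COMPLEX matrix
identities a block-walk-expanded family carries, plus the reality letters `im = 0` of the seven operators at the evaluation point
(the instance's letter — NODE O —, not the packaging's: `B13TermWalkData` records reality at the reference point only; δ𝓗's reality
follows from (182)), and the
conclusion is the cube-to-cube bound `blockNorm (blkA n) (blkB n) (δ𝓗_n) y y′ ≤ Cst·e^{−⅛δ15·d₁(y,y′)}`.  The real-part carriers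
are derived inside (`map_re_mul_of_im_eq_zero`, `map_re_add`, `map_re_sub`). [folklore] -/
theorem blockNorm190_of_blockNorm_le
    (blkB : (n : ℕ) → XB n → UT (Nf n)) (blkA : (n : ℕ) → XA n → UT (Nf n)) (blk3 : (n : ℕ) → X3 n → UT (Nf n))
    (Gt : (n : ℕ) → Matrix (XA n) (X3 n) ℂ) (W : (n : ℕ) → Matrix (X3 n) (XA n) ℂ)
    (D2H0 : (n : ℕ) → Matrix (X3 n) (XB n) ℂ)
    (H0 Hk A0 dH : (n : ℕ) → Matrix (XA n) (XB n) ℂ) (Dfr : (n : ℕ) → Matrix (XB n) (XA n) ℂ)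
    (M₀ : ℕ → ℝ) {δ₀ σ c BG θW cΔ A₀ AH₂ θD Cst δ15 : ℝ}
    (hδ₀ : 0 < δ₀) (hσ₀ : 0 < σ) (hσ : σ ≤ δ₀ / 8) (hc : B6.c0 δ₀ (σ / δ₀) ^ ν ≤ c)
    (hBG : 0 ≤ BG) (hθW : 0 ≤ θW) (hcΔ : 0 ≤ cΔ) (hA₀ : 0 ≤ A₀) (hAH₂ : 0 ≤ AH₂) (hθD : 0 ≤ θD) (hM₀ : ∀ n, 0 ≤ M₀ n)
    (hG : ∀ n y y', blockNorm (blkA n) (blk3 n) (Gt n) y y' ≤ BG * Real.exp (-(δ₀ * tdist1 (Nf n) y y')))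
    (h189 : ∀ n y y', blockNorm (blk3 n) (blkA n) (W n) y y' ≤ θW * Real.exp (-(δ₀ / 4 * tdist1 (Nf n) y y')))
    (hD2H0 : ∀ n y y', blockNorm (blk3 n) (blkB n) (D2H0 n) y y' ≤ cΔ * Real.exp (-(δ₀ * tdist1 (Nf n) y y')))
    (hH0 : ∀ n y y', blockNorm (blkA n) (blkB n) (H0 n) y y' ≤ A₀ * Real.exp (-(δ₀ * tdist1 (Nf n) y y')))
    (hH : ∀ n y y', blockNorm (blkA n) (blkB n) (Hk n) y y' ≤ AH₂ * Real.exp (-(δ₀ / 2 * tdist1 (Nf n) y y')))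
    (hDfr : ∀ n y y', blockNorm (blkB n) (blkA n) (Dfr n) y y' ≤ θD * Real.exp (-(δ₀ / 2 * tdist1 (Nf n) y y')))
    (h188 : ∀ n y y', blockNorm (blkA n) (blkB n) (A0 n) y y' ≤ M₀ n)
    (hGr : ∀ n i j, (Gt n i j).im = 0) (hWr : ∀ n i j, (W n i j).im = 0) (hD2r : ∀ n i j, (D2H0 n i j).im = 0)
    (hH0r : ∀ n i j, (H0 n i j).im = 0) (hHr : ∀ n i j, (Hk n i j).im = 0) (hA0r : ∀ n i j, (A0 n i j).im = 0)
    (hDfrr : ∀ n i j, (Dfr n i j).im = 0)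
    (h184 : ∀ n, A0 n + (Gt n * W n) * A0 n = Gt n * D2H0 n - (Gt n * W n) * H0 n)
    (h182 : ∀ n, dH n = (A0 n + H0 n) - Hk n * (Dfr n * (A0 n + H0 n)))
    (hq : qG 1 1 BG θW c < 1)
    (hCst : (1 * BG * (cΔ + 1 * θW * (A₀ + constA0 1 1 BG θW cΔ A₀ c) * c) * c + A₀) +
        1 * AH₂ * (1 * θD * (constA0 1 1 BG θW cΔ A₀ c + A₀) * c) * c ≤ Cst)
    (hδ15 : δ15 ≤ δ₀) :
    ∀ n (y y' : UT (Nf n)), blockNorm (blkA n) (blkB n) (dH n) y y' ≤ Cst * Real.exp (-(δ15 / 8 * tdist1 (Nf n) y y')) := by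
  -- δ𝓗 is entrywise real by (182) (g1-plan-1 GEN 14's W-2: seven reality letters suffice)
  have hsum : ∀ n i j, ((A0 n + H0 n) i j).im = 0 := fun n i j => by
    simp only [Matrix.add_apply, Complex.add_im, hA0r, hH0r, add_zero]
  have hdHr : ∀ n i j, (dH n i j).im = 0 := fun n i j => by
    rw [h182 n, Matrix.sub_apply, Complex.sub_im, hsum n,
      mul_im_eq_zero _ _ (hHr n) (mul_im_eq_zero _ _ (hDfrr n) (hsum n)), sub_zero]
  -- the real-part carriers from the complex ones and the reality letters
  have h184' : ∀ n, (A0 n).map Complex.re + ((Gt n).map Complex.re * (W n).map Complex.re) * (A0 n).map Complex.re =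
      (Gt n).map Complex.re * (D2H0 n).map Complex.re - ((Gt n).map Complex.re * (W n).map Complex.re) * (H0 n).map Complex.re :=
    fun n => by
      have h : (A0 n + (Gt n * W n) * A0 n).map Complex.re = (Gt n * D2H0 n - (Gt n * W n) * H0 n).map Complex.re := by
        rw [h184 n]
      rw [map_re_add, map_re_sub, map_re_mul_of_im_eq_zero _ _ (mul_im_eq_zero _ _ (hGr n) (hWr n)) (hA0r n),
        map_re_mul_of_im_eq_zero _ _ (mul_im_eq_zero _ _ (hGr n) (hWr n)) (hH0r n),
        map_re_mul_of_im_eq_zero _ _ (hGr n) (hWr n), map_re_mul_of_im_eq_zero _ _ (hGr n) (hD2r n)] at h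
      exact h
  have h182' : ∀ n, (dH n).map Complex.re = ((A0 n).map Complex.re + (H0 n).map Complex.re) -
      (Hk n).map Complex.re * ((Dfr n).map Complex.re * ((A0 n).map Complex.re + (H0 n).map Complex.re)) :=
    fun n => by
      have h : (dH n).map Complex.re = ((A0 n + H0 n) - Hk n * (Dfr n * (A0 n + H0 n))).map Complex.re := by
        rw [← h182 n]
      rw [map_re_sub, map_re_mul_of_im_eq_zero _ _ (hHr n) (mul_im_eq_zero _ _ (hDfrr n) (hsum n)),
        map_re_mul_of_im_eq_zero _ _ (hDfrr n) (hsum n), map_re_add] at h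
      exact h
  have hrow := block190_re_of_blockNorm_le blkB blkA blk3 Gt W D2H0 H0 Hk A0 dH Dfr M₀ hδ₀ hσ₀ hσ hc hBG hθW hcΔ hA₀
    hAH₂ hθD hM₀ hG h189 hD2H0 hH0 hH hDfr h188 h184' h182' hq hCst hδ15
  -- Cst ≥ 0 (all written-out constants are ≥ 0)
  have hc0 : 0 ≤ c := (pow_nonneg (B6RandomWalk.c0_nonneg δ₀ (σ / δ₀)) ν).trans hc
  have hcA0 : 0 ≤ constA0 1 1 BG θW cΔ A₀ c := constA0_nonneg zero_le_one zero_le_one hBG hθW hcΔ hA₀ hc0 hq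
  have hCst0 : 0 ≤ Cst := le_trans (by positivity) hCst
  -- read back into the block norm: every row x in cube y has mass ≤ the bound at (y, y′), the entries being real
  intro n y y'
  refine blockNorm_le_of_rowMass_le (blkA n) (blkB n) (dH n) y y' (mul_nonneg hCst0 (Real.exp_nonneg _)) fun x hx => ?_
  have hmass : rowMass (blkB n) (dH n) x y' = ∑ x' ∈ Finset.univ.filter (fun x' => blkB n x' = y'), |(dH n x x').re| := by
    refine Finset.sum_congr rfl fun x' _ => ?_
    have hz : dH n x x' = ((dH n x x').re : ℂ) := Complex.ext (by simp) (by simp [hdHr n x x'])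
    rw [hz, Complex.norm_real, Real.norm_eq_abs, Complex.ofReal_re]
  rw [hmass, ← hx]
  exact hrow n x y'

end Junction

end Summit.QuantumFields.BalabanUV.Beta.RemainderDecay190BlockNorm
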